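import Literature.Analysis.FluidPDE.Seregin2020AxisymmetricTypeII
import Literature.Analysis.FluidPDE.Seregin2023.TypeIIEulerZoomScenario
import HarnessLib

/-!
# Seregin 2024: remarks on potential Type II blow-ups of axisymmetric suitable weak solutions —
# the power-concentration scenario is excluded under an `L^q` (resp. vorticity `L^{q₁}`) bound

Topic `Analysis/FluidPDE`. Source: G. Seregin, *Remarks on Type II blowups of solutions to the
Navier–Stokes equations* (axisymmetric note), arXiv:2402.13229 [`Seregin2024AxisymTypeII`]; read
in the arXiv version (held text `paper:arxiv-2402.13229`): §1 (pp. 3–4: suitable weak solutions in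
`Q`, Type I/II via `g = inf{limsup A, limsup E, limsup C}`, the scenario (1.2) `M^{3,3}_{2,m₀}`,
(1.3) `A_{m₁} + D_m + E_m`, (1.4)–(1.5) `N^{s₁,l₁}`, Prop. 1.1, (1.13) `½ ≤ m < 1`), §2 (pp. 5–7:
axial symmetry, "we replace all spatial balls `B(a)` with cylinders `𝒞(a)`", (2.1) the decay
condition, (2.2) `l₁ ≤ s₁`, the restriction `m < (4l₁−3)/(l₁+1)`, **Proposition 2.3**,
**Corollary 2.4**). One file for §2's exclusion statements (D-0064).

## The printed statements (unit viscosity, no force, origin of the unit cylinder `Q`)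

Scenario (§1): (1.2) "there exists a sequence `r_k → 0` such that
`M^{3,3}_{2,m₀}(v,r_k) := r_k^{−2m₀} ∫_{Q(r_k)} |v|³ dz ≥ c₁ > 0` for all `k` and some `0 < m₀ <
1`"; (1.3) "`sup_{0<R≤1} (A_{m₁}(v,R) + D_m(q,R) + E_m(v,R)) ≤ c < ∞` with `m = 3m₀/(2+m₀)`, `m₁ =
2m−1`, `E_m(v,r) = r^{−m}∫_{Q(r)}|∇v|²`, `A_{m₁}(v,r) = sup_{−r²<t<0} r^{−m₁}∫_{B(r)}|v(x,t)|²dx`,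
`D_m(q,r) = r^{−2m}∫_{Q(r)}|q|^{3/2}`"; (1.4) `3/s₁ + 2/l₁ = 4`, `s₁, l₁ > 1`; (1.5)
"`N^{s₁,l₁}(v,r) := r^{−γ_* l₁} ∫_{−r²}^0 (∫_{B(r)} (|∇²v|^{s₁} + |∂_t v|^{s₁}) dx)^{l₁/s₁} dt ≤ c
< ∞` for all `0 < r < 1`", `γ_*(s₁,m) = 1 − (3/(2s₁) − 1)(1 − m)`; (1.13) "`½ ≤ m < 1`
(`⟺ m₁ ≥ 0 ⟺ 2/5 ≤ m₀ < 1`)". §2 (axial symmetry, cylinders `𝒞(a) = {|y'| < a, |y₃| < a}`):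
(2.1) "`|v(x,t)| ≤ c/|x'|^α` for all `z = (x,t) ∈ Q` such that `|x'| > 0`", `α = 2 − m`; (2.2)
"`l₁ ≤ s₁`"; the restriction "`m < (4l₁−3)/(l₁+1)`".

* **Proposition 2.3.** "Assume that condition [`m < (4l₁−3)/(l₁+1)`] holds and let in addition
  `ess sup_{−1<t<0} ∫_𝒞 |v(x,t)|^q dx =: C₀ < ∞` (2.3) with `q = 3/(2−m) ∈ [2,3[`. Then the origin
  `z = 0` might be a Type II singular point of `v`, described in (1.2), only if at least one of the
  conditions (1.3), (2.1), and (2.2) is violated."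
* **Corollary 2.4.** The same with (2.3) replaced by
  `ess sup_{−1<t<0} ∫_𝒞 |∇ × v(x,t)|^{q₁} dx =: C₀ < ∞`, `q₁ = 3/(3−m) ∈ [6/5, 3/2[`.

## Contents (named facts, D-0014)

* `seregin2024_axisym_typeII_scenario_excluded_Lq` — Proposition 2.3.
* `seregin2024_axisym_typeII_scenario_excluded_vorticity` — Corollary 2.4.

## Transcription notes (never stronger than print)

* *Logical form.* Under ALL standing hypotheses of §§1–2 — axisymmetric suitable weak pair `(v,q)`
  in `Q = 𝒞 × ]−1,0[`, (1.13), (1.4), (1.5), the restriction on `m`, (2.3) resp. its vorticity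
  form — together with (1.3), (2.1), (2.2) AND the origin being a Type II singular point
  (`Seregin2020.IsTypeIIAt 0 v G`: backward singular, `g = ∞` with upper limits, the note's §1
  definition "see [Seregin2010] for the original definition"), the concentration (1.2) FAILS:
  `M^{3,3}_{2,m₀}(v,r) → 0` as `r → 0⁺` (the negation of "`≥ c₁ > 0` along some `r_k → 0`" for a
  nonnegative quantity). All of (1.5) and the Type II hypothesis are kept even though the printed
  proof visibly uses only part of them — hypotheses are never dropped here.
* *Balls versus cylinders.* §2 replaces balls by the cylinders `𝒞(a)`; the HYPOTHESES are recorded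
  in the cylinder form (`SereginSverak2009.spaceCyl 0 R`, `parCyl 0 R = 𝒞(R) × ]−R²,0[`, which
  dominate the ball quantities since `B(R) ⊆ 𝒞(R)`), the CONCLUSION in the ball form
  `Seregin2023.morreyM (2m₀) 3 3 0 v r = r^{−2m₀}∫_{−r²}^0∫_{B(r)}|v|³ → 0` (dominated by the
  cylinder quantity), so that the recorded facts follow from print under either reading of §2's
  convention. The sum in (1.3) is split into three bounds by the same `c` (equivalent up to the
  value of the unspecified finite `c`); `sup_t` in `A_{m₁}` is imposed at every `t` (stronger).
* *Class.* As for `Seregin2020_axisymmetricSingularPoint_typeII`: `IsSuitableWeakSolutionOn` on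
  `SereginSverak2009.parCylOpens 0 1` (`ν = 1`, no force) plus the global classes
  `v ∈ L_{2,∞}(Q)`, `∇v = G ∈ L₂(Q)` (a weak spatial gradient on `Q`), `q ∈ L_{3/2}(Q)`; axial
  symmetry pointwise on every slice (`IsAxisymmetric (v t)`, `IsAxisymmetricScalar (q t)`).
* *(1.5).* `∇²v` is rendered by a field `H` with `H(t,x) d e = ∂_d ∂_e v`, i.e. for every direction
  `e` the field `(t,x) ↦ G(t,x)e` has weak spatial gradient `(t,x) ↦ (d ↦ H(t,x) d e)` on `Q`;
  `∂_t v` by a field `W` satisfying the distributional identity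
  `∫∫ ∂_tφ ⟪v,w⟫ = −∫∫ φ ⟪W,w⟫` for all `φ ∈ C_c^∞(Q)`, `w ∈ ℝ³`. Pointwise sizes `|∇²v|`, `|∂_t
  v|`, `|∇ × v|` are operator norms (`‖H‖`, `‖W‖`, and `‖G − G†‖` for the antisymmetric part
  `∇v − (∇v)ᵀ`, whose norm is `|∇ × v|` up to a universal factor); since the printed bounds are by
  unspecified finite constants `c`, `C₀`, norm-equivalence constants are immaterial.
* *(2.1)* at every `(t,x) ∈ Q` off the axis (`cylRadius x = |x'| > 0`), with the same letter `c`
  as print (any finite constant).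
* Not here: Lemma 2.1, Prop. 2.2 (conservation of `∫ (|ω_θ(u)|/r)^{l₁/2}` for the Euler limit),
  Prop. 1.1 (the Euler-scaling limit; cf. `Seregin2023.seregin2026_typeII_scenario_eulerLimit`),
  Props. 3.1, 4.1 (self-similar / discretely self-similar limits have finite kinetic energy).

## Mathlib / tree search

`lean search 'Seregin2024|2402.13229|scenario_excluded_Lq'`: no transcription (2026-08-26). Reused
vocabulary: `SereginSverak2009.spaceCyl/parCyl/parCylOpens`, `IsSuitableWeakSolutionOn`,
`HasWeakSpatialGradientOn`, `IsSpaceTimeTestOn`, `frobeniusNormSq`, `IsAxisymmetric(Scalar)`,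
`cylRadius`, `Seregin2020.IsTypeIIAt`, `Seregin2023.morreyM`. Related facts:
`Seregin2020_axisymmetricSingularPoint_typeII` (axisymmetric singular points are Type II),
`Seregin2023.seregin2026_typeII_scenario_excluded` (the general, non-symmetric scenario theorem).

## References

* G. Seregin, arXiv:2402.13229 (2024): §1 pp. 3–4 ((1.2)–(1.5), Prop. 1.1, (1.13)), §2 pp. 5–7
  ((2.1), (2.2), Prop. 2.3, Cor. 2.4). [`Seregin2024AxisymTypeII`]
* G. Seregin, Anal. Math. Phys. 10 (2020) no. 46 — Type I/II at a point, the tree's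
  `Seregin2020.IsTypeIIAt`. [`Seregin2020`]
-/

noncomputable section

open MeasureTheory Set Filter Metric Function
open _root_.Topology
open scoped ENNReal NNReal RealInnerProductSpace

namespace Literature.Analysis.FluidPDE

/-- The common hypothesis block of Seregin 2024, Prop. 2.3 / Cor. 2.4 WITHOUT the integrability
condition (2.3): an axisymmetric suitable weak pair `(v,q)` in the unit cylinder
`Q = 𝒞 × ]−1,0[` with weak gradient `G`, second spatial derivatives `H`, time derivative `W`,
exponents `m, s₁, l₁` subject to (1.13), (1.4), (2.2) and `m < (4l₁−3)/(l₁+1)`, the scenario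
bounds (1.3) and (1.5) with constant `c`, the decay condition (2.1) with exponent `α = 2 − m`, and
the origin a Type II singular point. A definition with a body (an abbreviation of the printed
standing assumptions, used by the two facts below), not a named fact. [cite: Seregin2024AxisymTypeII, §1 (1.3)–(1.5), (1.13); §2 (2.1), (2.2) (arXiv:2402.13229 pp. 3–7)] -/
def Seregin2024ScenarioHypotheses
    (v : ℝ → EuclideanSpace ℝ (Fin 3) → EuclideanSpace ℝ (Fin 3))
    (q : ℝ → EuclideanSpace ℝ (Fin 3) → ℝ)
    (G : ℝ → EuclideanSpace ℝ (Fin 3) → EuclideanSpace ℝ (Fin 3) →L[ℝ] EuclideanSpace ℝ (Fin 3))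
    (H : ℝ → EuclideanSpace ℝ (Fin 3) →
      EuclideanSpace ℝ (Fin 3) →L[ℝ] EuclideanSpace ℝ (Fin 3) →L[ℝ] EuclideanSpace ℝ (Fin 3))
    (W : ℝ → EuclideanSpace ℝ (Fin 3) → EuclideanSpace ℝ (Fin 3))
    (m s₁ l₁ c : ℝ) : Prop :=
  -- the class: suitable weak in `Q = 𝒞 × ]-1,0[` with the global classes of Def. 1.3 / §1
  IsSuitableWeakSolutionOn (SereginSverak2009.parCylOpens 0 1) 1 0 v q ∧
  (∃ C : ℝ≥0, ∀ᵐ t ∂(volume.restrict (Ioo (-1 : ℝ) 0)),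
    ∫⁻ x in SereginSverak2009.spaceCyl 0 1, ‖v t x‖ₑ ^ 2 ≤ C) ∧
  HasWeakSpatialGradientOn (SereginSverak2009.parCylOpens 0 1) v G ∧
  (∫⁻ z in SereginSverak2009.parCyl 0 1, ENNReal.ofReal (frobeniusNormSq (G z.1 z.2)) < ∞) ∧
  (∫⁻ z in SereginSverak2009.parCyl 0 1, ‖q z.1 z.2‖ₑ ^ (3 / 2 : ℝ) < ∞) ∧
  -- axial symmetry about the `x₃`-axis, slice-wise
  (∀ t ∈ Ioo (-1 : ℝ) 0, IsAxisymmetric (v t)) ∧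
  (∀ t ∈ Ioo (-1 : ℝ) 0, IsAxisymmetricScalar (q t)) ∧
  -- second spatial derivatives `H` and time derivative `W` in the weak sense on `Q`
  (∀ e : EuclideanSpace ℝ (Fin 3),
    HasWeakSpatialGradientOn (SereginSverak2009.parCylOpens 0 1) (fun t x => G t x e)
      (fun t x => (H t x).flip e)) ∧
  (∀ φ : ℝ → EuclideanSpace ℝ (Fin 3) → ℝ,
    IsSpaceTimeTestOn (SereginSverak2009.parCylOpens 0 1) φ →
    ∀ w : EuclideanSpace ℝ (Fin 3),
      ∫ t, ∫ x, deriv (fun s => φ s x) t * ⟪v t x, w⟫ = -∫ t, ∫ x, φ t x * ⟪W t x, w⟫) ∧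
  -- exponents: (1.13), (1.4), (2.2), the restriction on `m`
  1 / 2 ≤ m ∧ m < 1 ∧ 1 < s₁ ∧ 1 < l₁ ∧ 3 / s₁ + 2 / l₁ = 4 ∧ l₁ ≤ s₁ ∧
  m < (4 * l₁ - 3) / (l₁ + 1) ∧
  -- (1.3): `A_{m₁}`, `D_m`, `E_m` over the cylinders `𝒞(R) × ]-R²,0[`, `0 < R ≤ 1`, `m₁ = 2m-1`
  (∀ R ∈ Ioc (0 : ℝ) 1,
    (∀ t ∈ Ioo (-R ^ 2) 0,
      ENNReal.ofReal (R ^ (-(2 * m - 1))) *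
          ∫⁻ x in SereginSverak2009.spaceCyl 0 R, ‖v t x‖ₑ ^ 2 ≤ ENNReal.ofReal c) ∧
    ENNReal.ofReal (R ^ (-(2 * m))) *
        ∫⁻ z in SereginSverak2009.parCyl 0 R, ‖q z.1 z.2‖ₑ ^ (3 / 2 : ℝ) ≤ ENNReal.ofReal c ∧
    ENNReal.ofReal (R ^ (-m)) *
        ∫⁻ z in SereginSverak2009.parCyl 0 R, ENNReal.ofReal (frobeniusNormSq (G z.1 z.2)) ≤
      ENNReal.ofReal c) ∧
  -- (1.5): `N^{s₁,l₁}(v,R) ≤ c` for `0 < R < 1`, `γ_* = 1 - (3/(2s₁) - 1)(1 - m)`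
  (∀ R ∈ Ioo (0 : ℝ) 1,
    ENNReal.ofReal (R ^ (-((1 - (3 / (2 * s₁) - 1) * (1 - m)) * l₁))) *
        ∫⁻ t in Ioo (-R ^ 2) 0,
          (∫⁻ x in SereginSverak2009.spaceCyl 0 R, (‖H t x‖ₑ ^ s₁ + ‖W t x‖ₑ ^ s₁)) ^ (l₁ / s₁) ≤
      ENNReal.ofReal c) ∧
  -- (2.1): decay off the axis with exponent `α = 2 - m`
  (∀ z ∈ SereginSverak2009.parCyl (0 : ℝ × EuclideanSpace ℝ (Fin 3)) 1, 0 < cylRadius z.2 →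
    ‖v z.1 z.2‖ ≤ c / cylRadius z.2 ^ (2 - m)) ∧
  -- the origin is a Type II singular point (backward singular, `g = ∞`)
  Seregin2020.IsTypeIIAt 0 v G

/-- **Seregin 2024, Proposition 2.3.** Under the standing hypotheses
`Seregin2024ScenarioHypotheses v q G H W m s₁ l₁ c` (axisymmetric suitable weak pair in `Q`,
(1.13), (1.4), (2.2), `m < (4l₁−3)/(l₁+1)`, the bounds (1.3), (1.5), the decay (2.1), the origin a
Type II singular point) and the integrability (2.3)
`ess sup_{−1<t<0} ∫_𝒞 |v(x,t)|^q dx < ∞`, `q = 3/(2−m)`, the power concentration (1.2) cannot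
occur: `M^{3,3}_{2,m₀}(v,r) = r^{−2m₀}∫_{Q(r)}|v|³ → 0` as `r → 0⁺`, `m₀ = 2m/(3−m)` (i.e.
`m = 3m₀/(2+m₀)`). Printed: "the origin might be a Type II singular point of `v`, described in
(1.2), only if at least one of the conditions (1.3), (2.1), (2.2) is violated" (module docstring
for the cylinder/ball conventions). [cite: Seregin2024AxisymTypeII, Prop. 2.3 (arXiv:2402.13229 §2 p. 7)] -/
def seregin2024_axisym_typeII_scenario_excluded_Lq : Prop :=
  ∀ (v : ℝ → EuclideanSpace ℝ (Fin 3) → EuclideanSpace ℝ (Fin 3))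
    (q : ℝ → EuclideanSpace ℝ (Fin 3) → ℝ)
    (G : ℝ → EuclideanSpace ℝ (Fin 3) → EuclideanSpace ℝ (Fin 3) →L[ℝ] EuclideanSpace ℝ (Fin 3))
    (H : ℝ → EuclideanSpace ℝ (Fin 3) →
      EuclideanSpace ℝ (Fin 3) →L[ℝ] EuclideanSpace ℝ (Fin 3) →L[ℝ] EuclideanSpace ℝ (Fin 3))
    (W : ℝ → EuclideanSpace ℝ (Fin 3) → EuclideanSpace ℝ (Fin 3))
    (m s₁ l₁ c : ℝ),
    Seregin2024ScenarioHypotheses v q G H W m s₁ l₁ c →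
    (∃ C₀ : ℝ≥0, ∀ᵐ t ∂(volume.restrict (Ioo (-1 : ℝ) 0)),
      ∫⁻ x in SereginSverak2009.spaceCyl 0 1, ‖v t x‖ₑ ^ (3 / (2 - m)) ≤ C₀) →
    Tendsto
      (fun r : ℝ =>
        Seregin2023.morreyM (2 * (2 * m / (3 - m))) 3 3 (0 : ℝ × EuclideanSpace ℝ (Fin 3)) v r)
      (𝓝[>] 0) (𝓝 0)

/-- **Seregin 2024, Corollary 2.4.** The same conclusion as in Proposition 2.3
(`seregin2024_axisym_typeII_scenario_excluded_Lq`) when the integrability hypothesis (2.3) is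
replaced by the vorticity bound `ess sup_{−1<t<0} ∫_𝒞 |∇ × v(x,t)|^{q₁} dx < ∞`, `q₁ = 3/(3−m)`
(`|∇ × v|` rendered by the norm of the antisymmetric part `G − G†` of the weak gradient).
[cite: Seregin2024AxisymTypeII, Cor. 2.4 (arXiv:2402.13229 §2 p. 7)] -/
def seregin2024_axisym_typeII_scenario_excluded_vorticity : Prop :=
  ∀ (v : ℝ → EuclideanSpace ℝ (Fin 3) → EuclideanSpace ℝ (Fin 3))
    (q : ℝ → EuclideanSpace ℝ (Fin 3) → ℝ)
    (G : ℝ → EuclideanSpace ℝ (Fin 3) → EuclideanSpace ℝ (Fin 3) →L[ℝ] EuclideanSpace ℝ (Fin 3))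
    (H : ℝ → EuclideanSpace ℝ (Fin 3) →
      EuclideanSpace ℝ (Fin 3) →L[ℝ] EuclideanSpace ℝ (Fin 3) →L[ℝ] EuclideanSpace ℝ (Fin 3))
    (W : ℝ → EuclideanSpace ℝ (Fin 3) → EuclideanSpace ℝ (Fin 3))
    (m s₁ l₁ c : ℝ),
    Seregin2024ScenarioHypotheses v q G H W m s₁ l₁ c →
    (∃ C₀ : ℝ≥0, ∀ᵐ t ∂(volume.restrict (Ioo (-1 : ℝ) 0)),
      ∫⁻ x in SereginSverak2009.spaceCyl 0 1,
        ‖G t x - ContinuousLinearMap.adjoint (G t x)‖ₑ ^ (3 / (3 - m)) ≤ C₀) →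
    Tendsto
      (fun r : ℝ =>
        Seregin2023.morreyM (2 * (2 * m / (3 - m))) 3 3 (0 : ℝ × EuclideanSpace ℝ (Fin 3)) v r)
      (𝓝[>] 0) (𝓝 0)

end Literature.Analysis.FluidPDE

end
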